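import Mathlib
import Summits.Ventures.PercRepro2.Defs
import Summits.Ventures.PercRepro2.Harris
import Summits.Ventures.PercRepro2.Graph
import Summits.Ventures.PercRepro2.Induced
import Summits.Ventures.PercRepro2.VdBKahn
import Summits.Ventures.PercRepro2.NestIID

/-!
# The side-sign inequality (SIDE) — statement of record for the mechanism of the W-inequality
(blind cell PercRepro2, mine-1 g12; MINE-1.md §28, proofs/MINE1-SIDE.md)

One finite graph `ends : E → Sym2 V`, Bernoulli(`p`) edges, root `s`, avoided set `T`, test set `F`.
The STATUS of the cluster `C = C_ω(s)` is `C ∩ F`; its masses are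
`statusMass T F S = P(C ∩ F = S, C ∩ T = ∅) = P(S ⊆ C, C ∩ (T ∪ (F ∖ S)) = ∅)`.
Two INDEPENDENT copies with COMPLEMENTARY statuses `S₁ ⊔ S₂ = F` have the two-copy mass
`compMass T F S = statusMass T F S · statusMass T F (F ∖ S)`.

(SIDE): for every two INTERSECTING up-sets `Λ, Λ'` of `2^F` (upward closed within `F`, never containing
a set together with its complement in `F`), the same-side mass dominates the opposite-side mass:
`Σ_{S ∈ Λ, F∖S ∈ Λ'} compMass S ≤ Σ_{S ∈ Λ ∩ Λ'} compMass S`,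
i.e. the side signs `σ_Λ = 1[S₁ ∈ Λ] − 1[S₂ ∈ Λ]` of any two intersecting up-sets are positively
correlated under «every test vertex in exactly one copy». Every piece `G_r` of the W-inequality
(proofs/MINE1-SAMEKERNEL-FRAME.md §14) is an instance with `F := r`, `T := T ∪ (F ∖ r)`.
Census (mine-1 g12): 0 negatives on all graphs with ≤ 6 vertices, `|F| ≤ 4`, all up-set pairs,
three weight palettes; FALSE in the complementary (uniform 2-colouring) model and NOT implied by the
van den Berg–Kahn atoms of the status law — so it is stated here as a `Prop`, not proved.
The principal instance with `|F| = 2` is a van den Berg–Kahn atom (`sidePair_two`).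
-/

namespace Summit.Ventures.PercRepro2

section SideDefs

variable {V : Type*} {E : Type*} [Fintype E] [DecidableEq E] [Fintype V] [DecidableEq V]
  {R : Type*} [CommRing R] [LinearOrder R] [IsStrictOrderedRing R]

/-- The status mass `P(C ∩ F = S, C ∩ T = ∅)` — exactly `S` among the test set `F` is connected
to the root `s`, and `T` is avoided. -/
noncomputable def statusMass (p : E → R) (ends : E → Sym2 V) (s : V) (T F S : Finset V) : R :=
  prob p (connAll ends s S ∩ avoidAll ends s (T ∪ (F \ S)))

/-- The complementary two-copy mass `μ(S) = W_S · W_{F ∖ S}`: copy 1 has status `S`, the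
independent copy 2 has status `F ∖ S`, both avoid `T`. -/
noncomputable def compMass (p : E → R) (ends : E → Sym2 V) (s : V) (T F S : Finset V) : R :=
  statusMass p ends s T F S * statusMass p ends s T F (F \ S)

/-- An INTERSECTING UP-SET of `2^F`: a family of subsets of `F`, upward closed within `F`, never
containing both a set and its complement in `F`. -/
structure IntersectingUpSet (F : Finset V) where
  /-- the members -/
  fam : Finset (Finset V)
  sub : ∀ S ∈ fam, S ⊆ F
  upper : ∀ S ∈ fam, ∀ S', S ⊆ S' → S' ⊆ F → S' ∈ fam
  inter : ∀ S ∈ fam, F \ S ∉ fam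

/-- **(SIDE)** for a fixed graph, weights, root, avoided set `T` and test set `F`: for all intersecting
up-sets `Λ, Λ'` of `2^F`, the opposite-side complementary mass is at most the same-side mass. -/
def SideIneq (p : E → R) (ends : E → Sym2 V) (s : V) (T F : Finset V) : Prop :=
  ∀ Λ Λ' : IntersectingUpSet F,
    ∑ S ∈ F.powerset.filter (fun S => S ∈ Λ.fam ∧ F \ S ∈ Λ'.fam), compMass p ends s T F S ≤
      ∑ S ∈ F.powerset.filter (fun S => S ∈ Λ.fam ∧ S ∈ Λ'.fam), compMass p ends s T F S

/-- **(SIDE), the conjecture of record**: for every finite graph, admissible weights, root, avoided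
set and test set. -/
def SideRow : Prop :=
  ∀ {V : Type} {E : Type} [Fintype E] [DecidableEq E] [Fintype V] [DecidableEq V]
    (p : E → ℚ) (_hp : IsProbVec p) (ends : E → Sym2 V) (s : V) (T F : Finset V),
    Disjoint T F → s ∉ F → SideIneq p ends s T F

variable (p : E → R) (ends : E → Sym2 V) (s : V)

/-- The principal instance with two test vertices, `F = {x, y}`, `Λ = ↑x`, `Λ' = ↑y`, is the
van den Berg–Kahn atom `W_x W_y ≤ W_{xy} W_∅`: the opposite-side mass `compMass {x}` (copy 1 has
exactly `x`, copy 2 exactly `y`) is at most the same-side mass `compMass {x, y}`. -/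
theorem sidePair_two (hp : IsProbVec p) (x y : V) (hxy : x ≠ y) (T : Finset V) (hx : x ∉ T)
    (hy : y ∉ T) :
    compMass p ends s T {x, y} {x} ≤ compMass p ends s T {x, y} {x, y} := by
  have h := vdBK p hp ends s {x} {y} (T ∪ {y}) (T ∪ {x})
  have e1 : ({x, y} : Finset V) \ {x} = {y} := by
    ext v; simp only [Finset.mem_sdiff, Finset.mem_insert, Finset.mem_singleton]
    constructor
    · rintro ⟨h1, h2⟩; rcases h1 with rfl | rfl
      · exact absurd rfl h2
      · rfl
    · rintro rfl; exact ⟨Or.inr rfl, fun h => hxy h.symm⟩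
  have e2 : ({x, y} : Finset V) \ {y} = {x} := by
    ext v; simp only [Finset.mem_sdiff, Finset.mem_insert, Finset.mem_singleton]
    constructor
    · rintro ⟨h1, h2⟩; rcases h1 with rfl | rfl
      · rfl
      · exact absurd rfl h2
    · rintro rfl; exact ⟨Or.inl rfl, hxy⟩
  have e3 : ({x, y} : Finset V) \ {x, y} = ∅ := Finset.sdiff_self _
  have e4 : ({x, y} : Finset V) \ ∅ = {x, y} := Finset.sdiff_empty
  have e5 : (T ∪ {y}) ∩ (T ∪ {x}) = T := by
    ext v; simp only [Finset.mem_inter, Finset.mem_union, Finset.mem_singleton]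
    constructor
    · rintro ⟨h1 | rfl, h2 | rfl⟩
      · exact h1
      · exact h1
      · exact h2
      · exact absurd rfl hxy
    · intro h; exact ⟨Or.inl h, Or.inl h⟩
  have e6 : (T ∪ {y}) ∪ (T ∪ {x}) = T ∪ {x, y} := by
    ext v; simp only [Finset.mem_union, Finset.mem_singleton, Finset.mem_insert]; tauto
  have e7 : ({x} : Finset V) ∪ {y} = {x, y} := by
    ext v; simp only [Finset.mem_union, Finset.mem_singleton, Finset.mem_insert]
  have e8 : T ∪ (∅ : Finset V) = T := Finset.union_empty T
  unfold compMass statusMass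
  rw [e1, e2, e3, e4, e8, connAll_empty, Set.univ_inter]
  rw [e5, e6, e7] at h
  exact h

end SideDefs

end Summit.Ventures.PercRepro2
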